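import Summits.HubbardSuperconductivity.HubbardSuperconductivity.Theorems.NodalWardXYPerturbedXYOrderFixedVolume

/-!
# `PerturbedXYOrder` (stmt-HubbardSuperconductivity-10739) — line `schwarz-inheritance`: the crux volume by volume

`perturbedXYOrder_volumewise`: with `a = a₀/2` (`a₀` the unperturbed plateau of `realPlateau`), for EVERY radius
`ε` and every torus `L ≥ 2` there is `J₀ = J₀(ε, L)` such that for all `J ≥ J₀` every kernel admissible at radius
`ε` has `Z_K ≠ 0` and `a ≤ Re cratio L J K`.  Compared with the crux `PerturbedXYOrder`
(`∃ J₀ ε a, ∀ J ≥ J₀, ∀ L ≥ 2, …`) only the order of `∃ J₀` and `∀ L` is exchanged (and the smallness of `ε`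
dropped): the entire open content of the crux is the uniformity of `J₀` in `L` — the thermodynamic regime that
the registered crux-sized stub `stub_complexStability` (≡ the crux, `perturbedXYOrder_iff_complexStability`)
isolates.  Proof: `fv_master` with `η = a₀/8` and the algebra `cratio_K = n/z`, `‖z - 1‖, ‖n - n₀‖ ≤ η`,
`‖n₀‖ ≤ 1`.
-/

noncomputable section

namespace Summit.HubbardSuperconductivity.HubbardSuperconductivity.Theorems.PerturbedXYOrder

open MeasureTheory Literature.Probability.LatticeModels
open Summit.HubbardSuperconductivity.HubbardSuperconductivity.Theses.NodalWardXY

/-- **The crux, volume by volume** (and for every radius `ε`): with `a = a₀/2`, `a₀` the unperturbed plateau of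
`realPlateau`, for every `ε`, every `L ≥ 2` there is `J₀ = J₀(ε, L)` such that for all `J ≥ J₀` every kernel
admissible at radius `ε` has `Z_K ≠ 0` and `a ≤ Re cratio L J K` (`fv_master` with `η = a₀/8`).  Compared with
the crux `PerturbedXYOrder` (`∃ J₀ ε a, ∀ J ≥ J₀, ∀ L ≥ 2, …`) only the order of `∃ J₀` and `∀ L` is exchanged
(and the smallness of `ε` dropped): the entire open content of the crux is the uniformity of `J₀` in `L`. -/
theorem perturbedXYOrder_volumewise : ∃ a : ℝ, 0 < a ∧ ∀ (ε : ℝ) (L : ℕ) [NeZero L], 2 ≤ L →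
    ∃ J₀ : ℝ, ∀ J : ℝ, J₀ ≤ J → ∀ K : Bond L → Bond L → ℂ, Admissible L ε K →
      Zk J K ≠ 0 ∧ a ≤ (cratio L J K).re := by
  obtain ⟨J₁, a₀, ha₀, hplat⟩ := realPlateau
  refine ⟨a₀ / 2, by positivity, fun ε L _ hL => ?_⟩
  -- `a₀ ≤ 1` (the plateau is at most `1` on any torus)
  have ha₀1 : a₀ ≤ 1 := by
    obtain ⟨h1, h2⟩ := hplat J₁ le_rfl L hL
    exact h1.trans ((Complex.re_le_norm _).trans h2)
  obtain ⟨J₀, hJ₀⟩ := fv_master (L := L) ε (η := a₀ / 8) (by positivity)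
  refine ⟨max J₀ J₁, fun J hJ K hK => ?_⟩
  obtain ⟨hZ, hN⟩ := hJ₀ J (le_trans (le_max_left _ _) hJ) K hK
  obtain ⟨hre0, hn0⟩ := hplat J (le_trans (le_max_right _ _) hJ) L hL
  set Z0 : ℝ := ∫ θ in cube L, Real.exp (J * ∑ b : Bond L, Real.cos (θ (b.1 + Pi.single b.2 1) - θ b.1))
    with hZ0def
  have hZ0pos : 0 < Z0 := integral_xyWeight_pos (L := L) J
  have hZk0 : Zk J (0 : Bond L → Bond L → ℂ) = (Z0 : ℂ) := by rw [even_Zk_zero_eq]; rfl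
  have hL6 : (0:ℝ) < (L : ℝ) ^ 6 := by
    have := NeZero.pos L; positivity
  -- normalised quantities `z = Z_K/Z_0`, `n = num_K/(Z_0 L⁶)`, `n₀ = cratio 0`
  set z : ℂ := Zk J K / (Z0 : ℂ) with hzdef
  set n : ℂ := num J K / (Z0 : ℂ) / ((L : ℂ) ^ 6) with hndef
  set n₀ : ℂ := cratio L J (0 : Bond L → Bond L → ℂ) with hn₀def
  have hZ0ne : (Z0 : ℂ) ≠ 0 := Complex.ofReal_ne_zero.2 hZ0pos.ne'
  have hL6ne : ((L : ℂ)) ^ 6 ≠ 0 := pow_ne_zero _ (Nat.cast_ne_zero.2 (NeZero.ne L))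
  have hnormZ0 : ‖(Z0 : ℂ)‖ = Z0 := by rw [Complex.norm_real, Real.norm_eq_abs, abs_of_pos hZ0pos]
  have hnormL6 : ‖((L : ℂ)) ^ 6‖ = (L : ℝ) ^ 6 := by simp
  have hz1 : ‖z - 1‖ ≤ a₀ / 8 := by
    have e : z - 1 = (Zk J K - Zk J (0 : Bond L → Bond L → ℂ)) / (Z0 : ℂ) := by
      rw [hzdef, hZk0, sub_div, div_self hZ0ne]
    rw [e, norm_div, hnormZ0, div_le_iff₀ hZ0pos]
    exact hZ
  have hn1 : ‖n - n₀‖ ≤ a₀ / 8 := by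
    have e : n - n₀ = (num J K - num J (0 : Bond L → Bond L → ℂ)) / (Z0 : ℂ) / ((L : ℂ) ^ 6) := by
      rw [hndef, hn₀def, cratio, hZk0]; ring
    rw [e, norm_div, norm_div, hnormZ0, hnormL6, div_div, div_le_iff₀ (by positivity)]
    calc ‖num J K - num J (0 : Bond L → Bond L → ℂ)‖ ≤ a₀ / 8 * (L : ℝ) ^ 6 * Z0 := hN
      _ = a₀ / 8 * (Z0 * (L : ℝ) ^ 6) := by ring
  have hzne : z ≠ 0 := by
    intro hz0
    rw [hz0, zero_sub, norm_neg, norm_one] at hz1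
    linarith
  have hZne : Zk J K ≠ 0 := by
    intro h0
    exact hzne (by rw [hzdef, h0, zero_div])
  refine ⟨hZne, ?_⟩
  -- `cratio K = n / z`
  have hcr : cratio L J K = n / z := by
    rw [hndef, hzdef, cratio]
    field_simp
  -- `‖cratio K - n₀‖ ≤ (‖n - n₀‖ + ‖n₀‖ ‖z - 1‖) / ‖z‖ ≤ 2 (a₀/8) / (7/8)`
  have hzlow : 1 - a₀ / 8 ≤ ‖z‖ := by
    have := norm_sub_norm_le (1 : ℂ) z
    rw [norm_one, norm_sub_rev] at this
    linarith
  have hzpos : 0 < ‖z‖ := by linarith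
  have hdiff : ‖cratio L J K - n₀‖ ≤ 2 * (a₀ / 8) / (1 - a₀ / 8) := by
    have e : cratio L J K - n₀ = ((n - n₀) - n₀ * (z - 1)) / z := by
      rw [hcr]; field_simp; ring
    rw [e, norm_div, div_le_div_iff₀ hzpos (by linarith)]
    have h1 : ‖(n - n₀) - n₀ * (z - 1)‖ ≤ a₀ / 8 + 1 * (a₀ / 8) := by
      refine (norm_sub_le _ _).trans (add_le_add hn1 ?_)
      rw [norm_mul]
      exact mul_le_mul hn0 hz1 (norm_nonneg _) zero_le_one
    have h2 : ‖(n - n₀) - n₀ * (z - 1)‖ * (1 - a₀ / 8) ≤ (a₀ / 8 + 1 * (a₀ / 8)) * ‖z‖ :=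
      mul_le_mul h1 hzlow (by linarith) (by positivity)
    linarith
  have hre : n₀.re - ‖cratio L J K - n₀‖ ≤ (cratio L J K).re := by
    have h := Complex.re_le_norm (n₀ - cratio L J K)
    rw [Complex.sub_re, norm_sub_rev] at h
    linarith
  have hbound : 2 * (a₀ / 8) / (1 - a₀ / 8) ≤ a₀ / 2 := by
    rw [div_le_iff₀ (by linarith)]
    nlinarith
  linarith

end Summit.HubbardSuperconductivity.HubbardSuperconductivity.Theorems.PerturbedXYOrder

end
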